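import Literature.IUT.LogVolume.IsometryStablePureTensorCriterion
import HarnessLib

/-!
# The pure-tensor criterion at EVERY prime: factorwise isometries fix `(R_I)^∼` iff it is purely generated, as soon as all
# slots but one are AMPLE (`p` odd, or a unit of residue outside `𝔽_p`) — the `p = 2` mixed-packet invariant is the residue field

Classical non-archimedean linear algebra (nothing disputed; the [IUTchIV] locator records where the abc-iut cell uses it).  Sequel
of `IsometryStablePureTensorCriterion` (p490496) and `…Dyadic` (p492001): (PG) «`(R_I)^∼` is additively generated by its integral
pure tensors» ⟹ every factorwise isometry tuple fixes `(R_I)^∼` (every `p`); conversely at ODD `p`; at `p = 2` the converse FAILS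
for `ℚ₂(√−1) ⊗ ℚ₂(√−1)`.  THIS FILE names the invariant behind the prime `2`: the RESIDUE FIELD of the slots.  A slot field `k` is
AMPLE when the `ℤ_p`-span of its `ℚ_p`-linear isometries contains the coordinate idempotents of an orthogonal basis; this holds
(a) at odd `p` (`id + E_jj` is an isometry, p490496), (b) at ANY `p` when `k` has a unit `u` with `‖u − c‖ ≥ 1` for all `c ∈ ℚ_p`
(residue of `u` OUTSIDE `𝔽_p`, i.e. residue degree `≥ 2`): `u·b_j` exhibits a PARTNER `b_l`, `l ≠ j`, of the same norm class
(`‖λ b_l‖ = ‖b_j‖`, `λ ∈ ℚ_p^×`; `exists_partner_of_unit`), whence `E_jj = g₁ − g₂` for the isometries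
`g₁ : b_j ↦ b_j + λb_l, b_l ↦ λ⁻¹b_j` and `g₂ : b_j ↦ λ b_l, b_l ↦ λ⁻¹ b_j` (`exists_isometries_sub_eq_coordProj`), (c) when
`[k : ℚ_p] = 1`.  One slot `j₀` rides free:

**`mem_closure_pure_of_isometry_stable_of_ample`** (§4) — EVERY `p`, mixed slot fields: if every slot `i ≠ j₀` is ample and `(R_I)^∼`
is fixed by every factorwise isometry tuple, then (PG): for a multi-index `γ'` over the slots `≠ j₀` the operator
`P_{γ'} = ⊗_{i ≠ j₀} E^{(i)}_{γ'_iγ'_i} ⊗ id_{j₀}` maps `(R_I)^∼` into itself (§3, slot operators «isometry minus isometry»), has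
PURE-tensor values `(⊗_{i≠j₀} b^{(i)}_{γ'_i}) ⊗ w`, and `Σ_{γ'} P_{γ'} = id`.  Hence **`isometry_stable_iff_closure_pure_of_ample`** and
**`exists_isometry_mover_iff_not_closure_pure_of_ample`**: «mover ⟺ ¬(PG)» at EVERY prime for packets with at most one non-ample
slot — at `p = 2` whenever at most one slot has residue degree `1` (and degree `> 1`); SHARP by p492001 (`ℚ₂(√−1) ⊗ ℚ₂(√−1)`).

So the Y-29b n-slot word «mixed packets: kernel direction only» shrinks to «`p = 2` with at least two slots of residue degree `1`»
(there the operator-side criterion is abc-iut-E-t20's strict-contraction form).  CONTAINERS only; no side taken on [IUTchIII]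
Cor. 3.12.  PROOF-ONLY file (theorems, no definitions, no `Prop` facts, no `sorry`).
[cite: Mochizuki2012, IUTchIV Prop. 1.1 p. 9] [cite: WeilBNT1967, Ch. II §1, Prop. 3] [cite: NeukirchANT1999, Ch. II (4.8)]
-/

noncomputable section

open Module Function Set

namespace Literature.IUT.LogVolume
namespace PureTensorCriterion
/-! ## §1 One slot: a same-norm-class PARTNER makes the coordinate idempotent a difference of two isometries -/

section Slot

variable {p : ℕ} [Fact p.Prime] {E : Type} [NormedAddCommGroup E] [NormedSpace ℚ_[p] E] [IsUltrametricDist E]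
variable {κ : Type} [DecidableEq κ] (b : Basis κ ℚ_[p] E)

omit [IsUltrametricDist E] in
/-- The rank-one map `P_{ac} : x ↦ x_c·b_a` on a basis vector: `P_{ac}(b_m) = [m = c]·b_a`. [cite: WeilBNT1967, Ch. II §1, Prop. 3] -/
private theorem coordProj_basis (a c m : κ) :
    ((b.coord c).smulRight (b a)) (b m) = if m = c then b a else 0 := by
  rw [LinearMap.smulRight_apply, Basis.coord_apply, Basis.repr_self, Finsupp.single_apply]
  split_ifs <;> simp

omit [IsUltrametricDist E] [DecidableEq κ] in
/-- Norm of the rank-one map: `‖P_{ac} x‖ = ‖x_c‖·‖b_a‖`. [cite: WeilBNT1967, Ch. II §1, Prop. 3] -/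
private theorem norm_coordProj (a c : κ) (x : E) :
    ‖((b.coord c).smulRight (b a)) x‖ = ‖b.repr x c‖ * ‖b a‖ := by
  rw [LinearMap.smulRight_apply, Basis.coord_apply, norm_smul]

/-- **`E_jj = g₁ − g₂` for two ISOMETRIES when `b_j` has a partner `b_l` of the same norm class** (orthogonal basis `b`, `j ≠ l`,
`λ ∈ ℚ_p^×`, `‖λ·b_l‖ = ‖b_j‖`; every `p`): `g₁ : b_j ↦ b_j + λ b_l, b_l ↦ λ⁻¹ b_j`, `g₂ : b_j ↦ λ b_l, b_l ↦ λ⁻¹ b_j` (identity on the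
other basis vectors) and their inverses are norm-non-increasing, and `g₁ x − g₂ x = x_j·b_j`. [cite: WeilBNT1967, Ch. II §1, Prop. 3] -/
theorem exists_isometries_sub_eq_coordProj (hb : ∀ (x : E) (i : κ), ‖b.repr x i • b i‖ ≤ ‖x‖) {j l : κ} (hjl : j ≠ l)
    {t : ℚ_[p]} (ht : t ≠ 0) (hnorm : ‖t • b l‖ = ‖b j‖) :
    ∃ g₁ g₂ : E ≃ₗ[ℚ_[p]] E, (∀ x, ‖g₁ x‖ = ‖x‖) ∧ (∀ x, ‖g₂ x‖ = ‖x‖) ∧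
      ∀ x, g₁ x - g₂ x = ((b.coord j).smulRight (b j)) x := by
  set Pjj : E →ₗ[ℚ_[p]] E := (b.coord j).smulRight (b j) with hPjj
  set Pll : E →ₗ[ℚ_[p]] E := (b.coord l).smulRight (b l) with hPll
  set Pjl : E →ₗ[ℚ_[p]] E := (b.coord l).smulRight (b j) with hPjl
  set Plj : E →ₗ[ℚ_[p]] E := (b.coord j).smulRight (b l) with hPlj
  rw [norm_smul] at hnorm
  have nPjj : ∀ x, ‖Pjj x‖ ≤ ‖x‖ := fun x => by rw [hPjj, norm_coordProj, ← norm_smul]; exact hb x j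
  have nPll : ∀ x, ‖Pll x‖ ≤ ‖x‖ := fun x => by rw [hPll, norm_coordProj, ← norm_smul]; exact hb x l
  have htn : ‖t‖ ≠ 0 := norm_ne_zero_iff.mpr ht
  have nPjl : ∀ x, ‖t⁻¹ • Pjl x‖ ≤ ‖x‖ := fun x => by
    rw [norm_smul, norm_inv, hPjl, norm_coordProj, ← hnorm, ← mul_assoc, mul_comm ‖t‖⁻¹, mul_assoc, inv_mul_cancel_left₀ htn,
      ← norm_smul]; exact hb x l
  have nPlj : ∀ x, ‖t • Plj x‖ ≤ ‖x‖ := fun x => by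
    rw [norm_smul, hPlj, norm_coordProj, mul_left_comm, hnorm, ← norm_smul]; exact hb x j
  have n2Pll : ∀ x, ‖(2 : ℚ_[p]) • Pll x‖ ≤ ‖x‖ := fun x => by
    rw [norm_smul]
    have h2 : ‖(2 : ℚ_[p])‖ ≤ 1 := by rw [show (2 : ℚ_[p]) = ((2 : ℤ) : ℚ_[p]) by norm_num]; exact Padic.norm_int_le_one 2
    exact (mul_le_of_le_one_left (norm_nonneg _) h2).trans (nPll x)
  set g₁ : E →ₗ[ℚ_[p]] E := LinearMap.id + t⁻¹ • Pjl + t • Plj - Pll with hg₁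
  set g₂ : E →ₗ[ℚ_[p]] E := LinearMap.id - Pjj - Pll + t⁻¹ • Pjl + t • Plj with hg₂
  set h₁ : E →ₗ[ℚ_[p]] E := LinearMap.id - Pjj - (2 : ℚ_[p]) • Pll + t⁻¹ • Pjl + t • Plj with hh₁
  have hlj : l ≠ j := fun h => hjl h.symm
  have g₁j : g₁ (b j) = b j + t • b l := by
    simp only [hg₁, hPjl, hPlj, hPll, LinearMap.sub_apply, LinearMap.add_apply, LinearMap.smul_apply, LinearMap.id_apply,
      coordProj_basis, if_true, hjl, if_false]; module
  have g₁l : g₁ (b l) = t⁻¹ • b j := by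
    simp only [hg₁, hPjl, hPlj, hPll, LinearMap.sub_apply, LinearMap.add_apply, LinearMap.smul_apply, LinearMap.id_apply,
      coordProj_basis, if_true, hlj, if_false]; module
  have g₂j : g₂ (b j) = t • b l := by
    simp only [hg₂, hPjj, hPjl, hPlj, hPll, LinearMap.sub_apply, LinearMap.add_apply, LinearMap.smul_apply, LinearMap.id_apply,
      coordProj_basis, if_true, hjl, if_false]; module
  have g₂l : g₂ (b l) = t⁻¹ • b j := by
    simp only [hg₂, hPjj, hPjl, hPlj, hPll, LinearMap.sub_apply, LinearMap.add_apply, LinearMap.smul_apply, LinearMap.id_apply,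
      coordProj_basis, if_true, hlj, if_false]; module
  have h₁j : h₁ (b j) = t • b l := by
    simp only [hh₁, hPjj, hPjl, hPlj, hPll, LinearMap.sub_apply, LinearMap.add_apply, LinearMap.smul_apply, LinearMap.id_apply,
      coordProj_basis, if_true, hjl, if_false]; module
  have h₁l : h₁ (b l) = t⁻¹ • b j - b l := by
    simp only [hh₁, hPjj, hPjl, hPlj, hPll, LinearMap.sub_apply, LinearMap.add_apply, LinearMap.smul_apply, LinearMap.id_apply,
      coordProj_basis, if_true, hlj, if_false]; module
  have gm : ∀ m, m ≠ j → m ≠ l → g₁ (b m) = b m ∧ g₂ (b m) = b m ∧ h₁ (b m) = b m := fun m hmj hml => by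
    simp only [hg₁, hg₂, hh₁, hPjj, hPjl, hPlj, hPll, LinearMap.sub_apply, LinearMap.add_apply, LinearMap.smul_apply,
      LinearMap.id_apply, coordProj_basis, hmj, hml, if_false, smul_zero, add_zero, sub_zero, and_self]
  -- compositions are the identity (checked on the basis)
  have comp_eq_id : ∀ (u v : E →ₗ[ℚ_[p]] E), (∀ m, u (v (b m)) = b m) → u ∘ₗ v = LinearMap.id := fun u v huv =>
    b.ext fun m => by rw [LinearMap.comp_apply, LinearMap.id_apply, huv]
  have hbasis : ∀ (u v : E →ₗ[ℚ_[p]] E), u (v (b j)) = b j → u (v (b l)) = b l →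
      (∀ m, m ≠ j → m ≠ l → u (b m) = b m ∧ v (b m) = b m) → ∀ m, u (v (b m)) = b m := by
    intro u v huj hul hum m
    by_cases hmj : m = j; · subst hmj; exact huj
    by_cases hml : m = l; · subst hml; exact hul
    rw [(hum m hmj hml).2, (hum m hmj hml).1]
  have c₂₂ : g₂ ∘ₗ g₂ = LinearMap.id := comp_eq_id _ _ (hbasis _ _
    (by rw [g₂j, map_smul, g₂l, smul_smul, mul_inv_cancel₀ ht, one_smul])
    (by rw [g₂l, map_smul, g₂j, smul_smul, inv_mul_cancel₀ ht, one_smul])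
    (fun m hmj hml => ⟨(gm m hmj hml).2.1, (gm m hmj hml).2.1⟩))
  have c₁ : h₁ ∘ₗ g₁ = LinearMap.id := comp_eq_id _ _ (hbasis _ _
    (by rw [g₁j, map_add, map_smul, h₁j, h₁l, smul_sub, smul_smul, mul_inv_cancel₀ ht, one_smul]; abel)
    (by rw [g₁l, map_smul, h₁j, smul_smul, inv_mul_cancel₀ ht, one_smul])
    (fun m hmj hml => ⟨(gm m hmj hml).2.2, (gm m hmj hml).1⟩))
  have c₁' : g₁ ∘ₗ h₁ = LinearMap.id := comp_eq_id _ _ (hbasis _ _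
    (by rw [h₁j, map_smul, g₁l, smul_smul, mul_inv_cancel₀ ht, one_smul])
    (by rw [h₁l, map_sub, map_smul, g₁j, g₁l, smul_add, smul_smul, inv_mul_cancel₀ ht, one_smul]; abel)
    (fun m hmj hml => ⟨(gm m hmj hml).1, (gm m hmj hml).2.2⟩))
  -- norm-non-increasing
  have hsub : ∀ a c : E, ‖a - c‖ ≤ max ‖a‖ ‖c‖ := fun a c => by
    rw [sub_eq_add_neg, ← norm_neg c]; exact IsUltrametricDist.norm_add_le_max _ _
  have ng₁ : ∀ x, ‖g₁ x‖ ≤ ‖x‖ := fun x => by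
    simp only [hg₁, LinearMap.sub_apply, LinearMap.add_apply, LinearMap.smul_apply, LinearMap.id_apply]
    refine (hsub _ _).trans (max_le ?_ (nPll x))
    refine (IsUltrametricDist.norm_add_le_max _ _).trans (max_le ?_ (nPlj x))
    exact (IsUltrametricDist.norm_add_le_max _ _).trans (max_le le_rfl (nPjl x))
  have ng₂ : ∀ x, ‖g₂ x‖ ≤ ‖x‖ := fun x => by
    simp only [hg₂, LinearMap.sub_apply, LinearMap.add_apply, LinearMap.smul_apply, LinearMap.id_apply]
    refine (IsUltrametricDist.norm_add_le_max _ _).trans (max_le ?_ (nPlj x))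
    refine (IsUltrametricDist.norm_add_le_max _ _).trans (max_le ?_ (nPjl x))
    refine (hsub _ _).trans (max_le ?_ (nPll x))
    exact (hsub _ _).trans (max_le le_rfl (nPjj x))
  have nh₁ : ∀ x, ‖h₁ x‖ ≤ ‖x‖ := fun x => by
    simp only [hh₁, LinearMap.sub_apply, LinearMap.add_apply, LinearMap.smul_apply, LinearMap.id_apply]
    refine (IsUltrametricDist.norm_add_le_max _ _).trans (max_le ?_ (nPlj x))
    refine (IsUltrametricDist.norm_add_le_max _ _).trans (max_le ?_ (nPjl x))
    refine (hsub _ _).trans (max_le ?_ (n2Pll x))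
    exact (hsub _ _).trans (max_le le_rfl (nPjj x))
  refine ⟨LinearEquiv.ofLinear g₁ h₁ c₁' c₁, LinearEquiv.ofLinear g₂ g₂ c₂₂ c₂₂, fun x => ?_, fun x => ?_, fun x => ?_⟩
  · refine le_antisymm (ng₁ x) ((congrArg (‖·‖) (LinearMap.congr_fun c₁ x)).symm.trans_le (nh₁ _))
  · refine le_antisymm (ng₂ x) ((congrArg (‖·‖) (LinearMap.congr_fun c₂₂ x)).symm.trans_le (ng₂ _))
  · change g₁ x - g₂ x = Pjj x
    simp only [hg₁, hg₂, LinearMap.sub_apply, LinearMap.add_apply, LinearMap.smul_apply, LinearMap.id_apply]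
    abel

/-! ## §2 A unit of residue outside `𝔽_p` supplies a partner for every basis vector -/

/-- **Partners from a unit of residue outside `𝔽_p`**: for an orthogonal `ℚ_p`-basis `b` of a normed field `K ⊇ ℚ_p` and `u ∈ 𝒪_K`
with `‖u − c‖ ≥ 1` for all `c ∈ ℚ_p` (exists iff the residue degree is `≥ 2`), every `b_j` has a partner `l ≠ j`, `λ ∈ ℚ_p^×`,
`‖λ·b_l‖ = ‖b_j‖`: the sum of the terms `m ≠ j` of `u·b_j = Σ x_m b_m` is `(u − x_j)·b_j`, of norm `≥ ‖b_j‖`. [cite: WeilBNT1967, Ch. II §1, Prop. 3] -/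
theorem exists_partner_of_unit {K : Type} [NontriviallyNormedField K] [NormedAlgebra ℚ_[p] K] [IsUltrametricDist K]
    {κ : Type} [Fintype κ] [DecidableEq κ] (b : Basis κ ℚ_[p] K) (hb : ∀ (x : K) (i : κ), ‖b.repr x i • b i‖ ≤ ‖x‖)
    {u : K} (hu1 : ‖u‖ ≤ 1) (hu : ∀ c : ℚ_[p], 1 ≤ ‖u - algebraMap ℚ_[p] K c‖) (j : κ) :
    ∃ l, l ≠ j ∧ ∃ t : ℚ_[p], t ≠ 0 ∧ ‖t • b l‖ = ‖b j‖ := by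
  have hbj : 0 < ‖b j‖ := norm_pos_iff.mpr (b.ne_zero j)
  set y : K := u * b j with hy
  -- `v := Σ_{m ≠ j} y_m b_m = y − y_j b_j = (u − y_j)·b_j` has norm `≥ ‖b_j‖`
  have hsplit : ∑ m ∈ Finset.univ.erase j, b.repr y m • b m = (u - algebraMap ℚ_[p] K (b.repr y j)) * b j := by
    have h := b.sum_repr y
    rw [← Finset.sum_erase_add _ _ (Finset.mem_univ j)] at h
    rw [sub_mul, ← hy, ← Algebra.smul_def]
    exact eq_sub_of_add_eq h
  have hv : ‖b j‖ ≤ ‖∑ m ∈ Finset.univ.erase j, b.repr y m • b m‖ := by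
    rw [hsplit, norm_mul]
    exact le_mul_of_one_le_left (norm_nonneg _) (hu _)
  -- so some term `m ≠ j` has norm `≥ ‖b_j‖`; it is `≤ ‖y‖ ≤ ‖b_j‖`, hence a partner
  by_cases hne : (Finset.univ.erase j : Finset κ).Nonempty
  · obtain ⟨m, hm, hle⟩ := IsUltrametricDist.exists_norm_finsetSum_le_of_nonempty hne (fun m => b.repr y m • b m)
    have hmj : m ≠ j := Finset.ne_of_mem_erase hm
    have hge : ‖b j‖ ≤ ‖b.repr y m • b m‖ := hv.trans hle
    have hle' : ‖b.repr y m • b m‖ ≤ ‖b j‖ := (hb y m).trans (by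
      rw [hy, norm_mul]; exact mul_le_of_le_one_left (norm_nonneg _) hu1)
    refine ⟨m, hmj, b.repr y m, fun h0 => ?_, le_antisymm hle' hge⟩
    rw [h0, zero_smul, norm_zero] at hge; exact absurd hge (not_le.mpr hbj)
  · rw [Finset.not_nonempty_iff_eq_empty] at hne
    rw [hne, Finset.sum_empty, norm_zero] at hv; exact absurd hv (not_le.mpr hbj)

end Slot

/-! ## §3 Slot operators «isometry minus isometry» map `(R_I)^∼` into itself -/

section Packet

variable (p : ℕ) [hp : Fact p.Prime] {I : Type} [Fintype I] [DecidableEq I]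
  (k : I → Type) [∀ i, NontriviallyNormedField (k i)] [∀ i, NormedAlgebra ℚ_[p] (k i)]

/-- **Slot operators of the form `G − G′` (two isometries) or `id` map `(R_I)^∼` into itself** when `(R_I)^∼` is fixed pointwise
by every factorwise isometry tuple (slot-by-slot induction as in p490496's `map_mem_normalizedPacket_of_isometry_sub_id`;
`⊗(f_a at a, id elsewhere) = ⊗(G_a at a) − ⊗(G′_a at a)` by multilinearity of `PiTensorProduct.map`). [cite: Mochizuki2012, IUTchIV Prop. 1.1 p. 9] -/
theorem map_mem_normalizedPacket_of_isometry_sub_isometry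
    (hstab : ∀ g : (∀ i, k i ≃ₗ[ℚ_[p]] k i), (∀ i x, ‖g i x‖ = ‖x‖) →
      ∀ z ∈ normalizedPacket p k,
        (PiTensorProduct.congr g : PacketAlgebra p k ≃ₗ[ℚ_[p]] PacketAlgebra p k) z ∈ normalizedPacket p k)
    (f : ∀ i, k i →ₗ[ℚ_[p]] k i)
    (hf : ∀ i, f i = LinearMap.id ∨ ∃ G G' : k i ≃ₗ[ℚ_[p]] k i,
      (∀ x, ‖G x‖ = ‖x‖) ∧ (∀ x, ‖G' x‖ = ‖x‖) ∧ ∀ x, f i x = G x - G' x)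
    {z : PacketAlgebra p k} (hz : z ∈ normalizedPacket p k) :
    PiTensorProduct.map f z ∈ normalizedPacket p k := by
  -- `⊗(G at a, id elsewhere)` is `congr` of an isometry tuple
  have hcongr : ∀ (a : I) (G : k a ≃ₗ[ℚ_[p]] k a), (∀ x, ‖G x‖ = ‖x‖) → ∀ w ∈ normalizedPacket p k,
      PiTensorProduct.map (update (fun i => (LinearMap.id : k i →ₗ[ℚ_[p]] k i)) a (G : k a →ₗ[ℚ_[p]] k a)) w ∈
        normalizedPacket p k := by
    intro a G hG w hw
    let g : ∀ i, k i ≃ₗ[ℚ_[p]] k i := update (fun i => LinearEquiv.refl ℚ_[p] (k i)) a G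
    have hg : ∀ i x, ‖g i x‖ = ‖x‖ := fun i x => by
      by_cases hi : i = a; · subst hi; simp only [g, update_self, hG]
      simp only [g, update_of_ne hi, LinearEquiv.refl_apply]
    have hgf : (fun i => (g i : k i →ₗ[ℚ_[p]] k i)) =
        update (fun i => (LinearMap.id : k i →ₗ[ℚ_[p]] k i)) a (G : k a →ₗ[ℚ_[p]] k a) := by
      funext i
      by_cases hi : i = a; · subst hi; simp only [g, update_self]
      simp only [g, update_of_ne hi, LinearEquiv.refl_toLinearMap]
    have h : (PiTensorProduct.congr g : PacketAlgebra p k ≃ₗ[ℚ_[p]] PacketAlgebra p k) w =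
        PiTensorProduct.map (fun i => (g i : k i →ₗ[ℚ_[p]] k i)) w := rfl
    rw [← hgf, ← h]
    exact hstab g hg w hw
  have hone : ∀ (a : I) (w : PacketAlgebra p k), w ∈ normalizedPacket p k →
      PiTensorProduct.map (update (fun i => (LinearMap.id : k i →ₗ[ℚ_[p]] k i)) a (f a)) w ∈
        normalizedPacket p k := by
    intro a w hw
    rcases hf a with hid | ⟨G, G', hG, hG', hfa⟩
    · have hupd : update (fun i => (LinearMap.id : k i →ₗ[ℚ_[p]] k i)) a (f a) =
          fun i => (LinearMap.id : k i →ₗ[ℚ_[p]] k i) := by rw [hid]; exact update_eq_self a _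
      rw [hupd, PiTensorProduct.map_id, LinearMap.id_apply]; exact hw
    · have hfa' : f a = (G : k a →ₗ[ℚ_[p]] k a) - (G' : k a →ₗ[ℚ_[p]] k a) := by
        ext x; rw [hfa, LinearMap.sub_apply, LinearEquiv.coe_coe, LinearEquiv.coe_coe]
      have hsplit : PiTensorProduct.map (update (fun i => (LinearMap.id : k i →ₗ[ℚ_[p]] k i)) a (f a)) =
          PiTensorProduct.map (update (fun i => (LinearMap.id : k i →ₗ[ℚ_[p]] k i)) a (G : k a →ₗ[ℚ_[p]] k a)) -
          PiTensorProduct.map (update (fun i => (LinearMap.id : k i →ₗ[ℚ_[p]] k i)) a (G' : k a →ₗ[ℚ_[p]] k a)) := by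
        rw [hfa']
        exact (PiTensorProduct.mapMultilinear ℚ_[p] k k).map_update_sub _ a _ _
      rw [hsplit, LinearMap.sub_apply]
      exact sub_mem (hcongr a G hG w hw) (hcongr a G' hG' w hw)
  -- induction on the set of switched slots
  have hind : ∀ s : Finset I, ∀ w ∈ normalizedPacket p k,
      PiTensorProduct.map (fun i => if i ∈ s then f i else LinearMap.id) w ∈ normalizedPacket p k := by
    intro s
    induction s using Finset.induction_on with
    | empty =>
      intro w hw; simpa only [Finset.notMem_empty, if_false, PiTensorProduct.map_id, LinearMap.id_apply] using hw
    | insert a s ha ih =>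
      intro w hw
      have hcomp : (fun i => if i ∈ insert a s then f i else (LinearMap.id : k i →ₗ[ℚ_[p]] k i)) =
          fun i => (if i ∈ s then f i else (LinearMap.id : k i →ₗ[ℚ_[p]] k i)) ∘ₗ
            update (fun i => (LinearMap.id : k i →ₗ[ℚ_[p]] k i)) a (f a) i := by
        funext i
        by_cases hi : i = a
        · subst hi; rw [update_self, if_pos (Finset.mem_insert_self _ _), if_neg ha, LinearMap.id_comp]
        · rw [update_of_ne hi, LinearMap.comp_id]; simp only [Finset.mem_insert, hi, false_or]
      rw [hcomp, PiTensorProduct.map_comp, LinearMap.comp_apply]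
      exact ih _ (hone a w hw)
  simpa only [Finset.mem_univ, if_true] using hind Finset.univ z hz

/-! ## §4 All slots but one ample ⟹ (fixed ⟹ purely generated), at every prime -/

/-- **EVERY `p`: if all slots but one are AMPLE and `(R_I)^∼` is fixed (pointwise) by every factorwise `ℚ_p`-linear isometry tuple,
then `(R_I)^∼` is generated by its pure tensors.**  Ample: `p ≠ 2`, or a unit `u ∈ k_i` with `‖u − c‖ ≥ 1` for all `c ∈ ℚ_p` (residue
degree `≥ 2`), or `[k_i : ℚ_p] = 1`.  Proof: `P_{γ'} = ⊗_{i ≠ j₀} E^{(i)}_{γ'_iγ'_i} ⊗ id_{j₀}` maps `(R_I)^∼` into itself (§1–§3), takes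
pure-tensor values (range on the tensor basis), and `Σ_{γ'} P_{γ'} = id`. [cite: Mochizuki2012, IUTchIV Prop. 1.1 p. 9] [cite: WeilBNT1967, Ch. II §1, Prop. 3] -/
theorem mem_closure_pure_of_isometry_stable_of_ample [∀ i, IsUltrametricDist (k i)] [∀ i, ProperSpace (k i)] (j₀ : I)
    (hample : ∀ i, i ≠ j₀ → p ≠ 2 ∨ (∃ u : k i, ‖u‖ ≤ 1 ∧ ∀ c : ℚ_[p], 1 ≤ ‖u - algebraMap ℚ_[p] (k i) c‖) ∨
      finrank ℚ_[p] (k i) = 1)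
    (hstab : ∀ g : (∀ i, k i ≃ₗ[ℚ_[p]] k i), (∀ i x, ‖g i x‖ = ‖x‖) →
      ∀ z ∈ normalizedPacket p k,
        (PiTensorProduct.congr g : PacketAlgebra p k ≃ₗ[ℚ_[p]] PacketAlgebra p k) z ∈ normalizedPacket p k)
    {z : PacketAlgebra p k} (hz : z ∈ normalizedPacket p k) :
    z ∈ AddSubgroup.closure
      {t : PacketAlgebra p k | t ∈ normalizedPacket p k ∧ ∃ x : Π i, k i, t = purePacket p k x} := by
  have hbas : ∀ i, ∃ b : Basis (Fin (finrank ℚ_[p] (k i))) ℚ_[p] (k i),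
      ∀ (x : k i) (j : Fin (finrank ℚ_[p] (k i))), ‖b.repr x j • b j‖ ≤ ‖x‖ := fun i => by
    haveI := finiteDimensional p (k i)
    exact TameDualPair.exists_dominated_basis
  choose b hb using hbas
  -- in an ample slot every coordinate projection is `id` or a difference of two isometries
  have hproj : ∀ i, i ≠ j₀ → ∀ m : Fin (finrank ℚ_[p] (k i)),
      ((b i).coord m).smulRight (b i m) = LinearMap.id ∨ ∃ G G' : k i ≃ₗ[ℚ_[p]] k i,
        (∀ x, ‖G x‖ = ‖x‖) ∧ (∀ x, ‖G' x‖ = ‖x‖) ∧ ∀ x, ((b i).coord m).smulRight (b i m) x = G x - G' x := by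
    intro i hi m
    rcases hample i hi with hp2 | ⟨u, hu1, hu⟩ | h1
    · obtain ⟨D, hD, hDx⟩ := exists_isometry_add_coordProj p hp2 (b i) (hb i) m
      exact Or.inr ⟨D, LinearEquiv.refl ℚ_[p] (k i), hD, fun x => rfl, fun x => by
        rw [hDx, LinearEquiv.refl_apply, add_sub_cancel_left]⟩
    · obtain ⟨l, hl, t, ht, hnorm⟩ := exists_partner_of_unit (b i) (hb i) hu1 hu m
      obtain ⟨G, G', hG, hG', hGG⟩ := exists_isometries_sub_eq_coordProj (b i) (hb i) (Ne.symm hl) ht hnorm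
      exact Or.inr ⟨G, G', hG, hG', fun x => (hGG x).symm⟩
    · refine Or.inl ((b i).ext fun m' => ?_)
      haveI : Subsingleton (Fin (finrank ℚ_[p] (k i))) := by rw [h1]; infer_instance
      rw [coordProj_basis, if_pos (Subsingleton.elim _ _), LinearMap.id_apply, Subsingleton.elim m m']
  -- the operators `P_{γ'}` and their pure-tensor values
  set B := Basis.piTensorProduct b with hB
  let F : (∀ i : {i : I // i ≠ j₀}, Fin (finrank ℚ_[p] (k i.1))) → ∀ i, k i →ₗ[ℚ_[p]] k i := fun γ' i =>
    if h : i = j₀ then LinearMap.id else ((b i).coord (γ' ⟨i, h⟩)).smulRight (b i (γ' ⟨i, h⟩))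
  let y : (∀ i : {i : I // i ≠ j₀}, Fin (finrank ℚ_[p] (k i.1))) → ∀ i, k i := fun γ' i =>
    if h : i = j₀ then 0 else b i (γ' ⟨i, h⟩)
  have hupd : ∀ δ : ∀ i, Fin (finrank ℚ_[p] (k i)),
      update (y fun i : {i : I // i ≠ j₀} => δ i.1) j₀ (b j₀ (δ j₀)) = fun i => b i (δ i) := by
    intro δ; funext i
    by_cases hi : i = j₀; · subst hi; rw [update_self]
    rw [update_of_ne hi]; simp only [y, dif_neg hi]
  have key : ∀ (γ' : ∀ i : {i : I // i ≠ j₀}, Fin (finrank ℚ_[p] (k i.1))) (δ : ∀ i, Fin (finrank ℚ_[p] (k i))),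
      PiTensorProduct.map (F γ') (B δ) = if γ' = (fun i : {i : I // i ≠ j₀} => δ i.1) then B δ else 0 := by
    intro γ' δ
    rw [hB, Basis.piTensorProduct_apply, PiTensorProduct.map_tprod]
    split_ifs with h
    · subst h
      congr 1
      funext i
      by_cases hi : i = j₀; · subst hi; simp only [F, dif_pos rfl, LinearMap.id_apply]
      simp only [F, dif_neg hi]; rw [coordProj_basis, if_pos rfl]
    · have hex : ∃ (i : I) (hi : i ≠ j₀), δ i ≠ γ' ⟨i, hi⟩ := by
        by_contra hall
        push Not at hall
        exact h (funext fun i => (hall i.1 i.2).symm)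
      obtain ⟨i, hi, hne⟩ := hex
      refine (PiTensorProduct.tprod ℚ_[p] (s := k)).map_coord_zero i ?_
      simp only [F, dif_neg hi]; rw [coordProj_basis, if_neg hne]
  -- (1) `P_{γ'} z ∈ (R_I)^∼`
  have hmem : ∀ γ', PiTensorProduct.map (F γ') z ∈ normalizedPacket p k := fun γ' =>
    map_mem_normalizedPacket_of_isometry_sub_isometry p k hstab (F γ') (fun i => by
      by_cases hi : i = j₀; · left; simp only [F, dif_pos hi]
      simp only [F, dif_neg hi]; exact hproj i hi _) hz
  -- (2) `P_{γ'} z` is a pure tensor `(⊗_{i≠j₀} b_{γ'_i}) ⊗ w`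
  have hpure : ∀ γ', ∃ w : k j₀, PiTensorProduct.map (F γ') z = purePacket p k (update (y γ') j₀ w) := by
    intro γ'
    let L : k j₀ →ₗ[ℚ_[p]] PacketAlgebra p k := (PiTensorProduct.tprod ℚ_[p] (s := k)).toLinearMap (y γ') j₀
    have hrange : LinearMap.range (PiTensorProduct.map (F γ')) ≤ LinearMap.range L := by
      rw [LinearMap.range_eq_map, ← B.span_eq, Submodule.map_span, Submodule.span_le]
      rintro _ ⟨_, ⟨δ, rfl⟩, rfl⟩
      rw [key]
      split_ifs with h
      · subst h
        refine ⟨b j₀ (δ j₀), ?_⟩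
        rw [MultilinearMap.toLinearMap_apply, hupd δ, hB, Basis.piTensorProduct_apply]
      · exact zero_mem _
    obtain ⟨w, hw⟩ := hrange (LinearMap.mem_range_self _ z)
    exact ⟨w, by rw [← hw, MultilinearMap.toLinearMap_apply]; rfl⟩
  -- (3) `Σ_{γ'} P_{γ'} = id`
  have hsum : ∑ γ', PiTensorProduct.map (F γ') = LinearMap.id := by
    refine B.ext fun δ => ?_
    rw [LinearMap.sum_apply, LinearMap.id_apply]
    simp_rw [key]
    rw [Finset.sum_ite_eq', if_pos (Finset.mem_univ _)]
  have hz' : z = ∑ γ', PiTensorProduct.map (F γ') z := by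
    conv_lhs => rw [← LinearMap.id_apply (R := ℚ_[p]) z, ← hsum]
    rw [LinearMap.sum_apply]
  rw [hz']
  refine AddSubgroup.sum_mem _ fun γ' _ => AddSubgroup.subset_closure ⟨hmem γ', ?_⟩
  obtain ⟨w, hw⟩ := hpure γ'
  exact ⟨_, hw⟩

/-- **EVERY `p` — THE DIVIDING LINE for packets with at most one non-ample slot**: `(R_I)^∼` is fixed by every tuple of factorwise
`ℚ_p`-linear isometries **iff** (PG); at `p = 2` this covers every mixed packet with at most one slot of residue degree `1` and degree
`> 1` (two such slots can break it: p492001). [cite: Mochizuki2012, IUTchIV Prop. 1.1 p. 9] [cite: WeilBNT1967, Ch. II §1, Prop. 3] -/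
theorem isometry_stable_iff_closure_pure_of_ample [∀ i, IsUltrametricDist (k i)] [∀ i, ProperSpace (k i)] (j₀ : I)
    (hample : ∀ i, i ≠ j₀ → p ≠ 2 ∨ (∃ u : k i, ‖u‖ ≤ 1 ∧ ∀ c : ℚ_[p], 1 ≤ ‖u - algebraMap ℚ_[p] (k i) c‖) ∨
      finrank ℚ_[p] (k i) = 1) :
    (∀ g : (∀ i, k i ≃ₗ[ℚ_[p]] k i), (∀ i x, ‖g i x‖ = ‖x‖) →
      (PiTensorProduct.congr g : PacketAlgebra p k ≃ₗ[ℚ_[p]] PacketAlgebra p k) ''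
          (normalizedPacket p k : Set (PacketAlgebra p k)) = normalizedPacket p k) ↔
    ∀ z ∈ normalizedPacket p k, z ∈ AddSubgroup.closure
      {t : PacketAlgebra p k | t ∈ normalizedPacket p k ∧ ∃ x : Π i, k i, t = purePacket p k x} := by
  haveI : Nonempty I := ⟨j₀⟩
  refine ⟨fun h z hz => mem_closure_pure_of_isometry_stable_of_ample p k j₀ hample (fun g hg w hw => ?_) hz,
    fun h g hg => congr_image_normalizedPacket_eq_of_closure_pure p k h g hg⟩
  have hmem : (PiTensorProduct.congr g : PacketAlgebra p k ≃ₗ[ℚ_[p]] PacketAlgebra p k) w ∈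
      (PiTensorProduct.congr g : PacketAlgebra p k ≃ₗ[ℚ_[p]] PacketAlgebra p k) ''
        (normalizedPacket p k : Set (PacketAlgebra p k)) := mem_image_of_mem _ hw
  rwa [h g hg] at hmem

/-- **EVERY `p` — mover form**: in a packet with at most one non-ample slot, some factorwise-isometry tuple moves some element of
`(R_I)^∼` out of `(R_I)^∼` **iff** some element of `(R_I)^∼` lies outside the additive span of the integral pure tensors.
[cite: Mochizuki2012, IUTchIV Prop. 1.1 p. 9] [cite: WeilBNT1967, Ch. II §1, Prop. 3] -/
theorem exists_isometry_mover_iff_not_closure_pure_of_ample [∀ i, IsUltrametricDist (k i)] [∀ i, ProperSpace (k i)]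
    (j₀ : I) (hample : ∀ i, i ≠ j₀ → p ≠ 2 ∨ (∃ u : k i, ‖u‖ ≤ 1 ∧ ∀ c : ℚ_[p], 1 ≤ ‖u - algebraMap ℚ_[p] (k i) c‖) ∨
      finrank ℚ_[p] (k i) = 1) :
    (∃ (g : ∀ i, k i ≃ₗ[ℚ_[p]] k i) (_ : ∀ i x, ‖g i x‖ = ‖x‖) (z : PacketAlgebra p k),
        z ∈ normalizedPacket p k ∧
        (PiTensorProduct.congr g : PacketAlgebra p k ≃ₗ[ℚ_[p]] PacketAlgebra p k) z ∉ normalizedPacket p k) ↔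
    ∃ w ∈ normalizedPacket p k, w ∉ AddSubgroup.closure
      {t : PacketAlgebra p k | t ∈ normalizedPacket p k ∧ ∃ x : Π i, k i, t = purePacket p k x} := by
  haveI : Nonempty I := ⟨j₀⟩
  refine ⟨fun ⟨g, hg, z, hz, hmove⟩ => not_closure_pure_of_isometry_mover p k g hg hz hmove, fun ⟨w, hw, hnot⟩ => ?_⟩
  by_contra hno
  push Not at hno
  exact hnot (mem_closure_pure_of_isometry_stable_of_ample p k j₀ hample hno hw)

end Packet

end PureTensorCriterion
end Literature.IUT.LogVolume
end
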